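import Literature.Computability.Complexity.DirectProductSampler
import HarnessLib

/-!
# Uniform direct-product decoding (IJKW), III: the decoder and the main theorem

Trunk T-CPLX-CORE, continuation of `DirectProductDecoding.lean` and
`DirectProductSampler.lean` (fourth instalment of the decomposition of
`Literature.Computability.Learning.cikk_natural_implies_learning`). Here the analysis of the
decoder `decode` (IJKW Algorithm 1 with fixed sampling steps): the answering steps at a point
`x` are `|U| · consCnt x` and the wrongly answering ones `|U| · redCnt x` (`card_answers_eq`,
`card_answersWrong_eq`), the number of step sequences on which the decoder errs at `x` is at
most `(non-answering)^t + h(x) · (all)^t` (`card_wrongSteps_le`, by induction on `t`), whence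
IJKW Lemma 3.8 in summed form (`sum_card_wrongSteps_le`: over an excellent row the decoder errs
on at most a `3δ/16` fraction of the pairs (point, steps)), the Markov step fixing the internal
randomness (IJKW Remark 3.3) and the **main theorem** `directProduct_decoding`
(IJKW Thm. 1.2 / CIKK Thm. 4.1, true-value variant, explicit constants): at least a `3ε/16`
fraction of the triples (position set, trusted tuple, steps) give a decoder that computes `f` on
all but a `δ` fraction of `U`.

## References

* R. Impagliazzo, R. Jaiswal, V. Kabanets, A. Wigderson, *Uniform direct product theorems:
  simplified, optimized, and derandomized*, SIAM J. Comput. 39(4) (2010), Thm. 1.2, Thm. 3.2,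
  Lemma 3.8, Remark 3.3 [ImpagliazzoEtAl2010].
* M. Carmosino, R. Impagliazzo, V. Kabanets, A. Kolokolova, *Learning algorithms from natural
  proofs*, CCC 2016, Thm. 4.1 [CarmosinoImpagliazzoKabanetsKolokolova2016].
-/

open Finset Real

namespace Literature.Computability.Complexity

namespace DirectProduct

variable {U R : Type*} [Fintype U] [DecidableEq U] [DecidableEq R] {k : ℕ}
variable (C : (Fin k → U) → Fin k → R) (f : U → R)

/-! ### Counting the answering steps -/

/-- Overwriting one coordinate: `#{y : Q (update y j x)} = |U| · #{y' : y' j = x ∧ Q y'}`.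
[folklore] -/
theorem card_filter_update (j : Fin k) (x : U) (Q : (Fin k → U) → Prop) [DecidablePred Q] :
    (univ.filter fun y : Fin k → U => Q (Function.update y j x)).card =
      Fintype.card U * (univ.filter fun y' : Fin k → U => y' j = x ∧ Q y').card := by
  rw [card_eq_sum_card_fiberwise (f := fun y : Fin k → U => y j) (t := univ)
    (fun _ _ => mem_univ _), ← Finset.card_univ, ← smul_eq_mul, ← Finset.sum_const]
  refine Finset.sum_congr rfl fun u _ => ?_
  refine Finset.card_bij' (fun y _ => Function.update y j x) (fun y' _ => Function.update y' j u)
    ?_ ?_ ?_ ?_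
  · intro y hy
    simp only [mem_filter, mem_univ, true_and] at hy ⊢
    exact ⟨Function.update_self _ _ _, hy.1⟩
  · intro y' hy'
    simp only [mem_filter, mem_univ, true_and] at hy' ⊢
    refine ⟨?_, Function.update_self _ _ _⟩
    rw [Function.update_idem, ← hy'.1, Function.update_eq_self]
    exact hy'.2
  · intro y hy
    simp only [mem_filter, mem_univ, true_and] at hy
    rw [Function.update_idem, ← hy.2, Function.update_eq_self]
  · intro y' hy'
    simp only [mem_filter, mem_univ, true_and] at hy'
    rw [Function.update_idem, ← hy'.1, Function.update_eq_self]

omit [DecidableEq U] in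
/-- With the true values trusted, a step `(j, y)` answers at `x` iff `j` is free and the
completion by `update y j x` is consistent. [cite: ImpagliazzoEtAl2010, Algorithm 1] -/
theorem answers_iff (P : Finset (Fin k)) (a : Fin k → U) (x : U) (σ : Fin k × (Fin k → U)) :
    Answers C P a (f ∘ a) x σ ↔ σ.1 ∉ P ∧ Function.update σ.2 σ.1 x ∈ cons C f P a := by
  unfold Answers stepTuple
  rw [mem_cons, Finset.disjoint_left]
  refine and_congr Iff.rfl (forall₂_congr fun i hi => ?_)
  rw [mem_errSet, not_not, Function.comp_apply, fill_apply_of_mem hi]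

/-- The steps answering at `x`. [cite: ImpagliazzoEtAl2010, Algorithm 1] -/
def answerSteps (P : Finset (Fin k)) (a : Fin k → U) (x : U) : Finset (Fin k × (Fin k → U)) :=
  univ.filter fun σ => Answers C P a (f ∘ a) x σ

/-- The steps answering WRONGLY at `x`. [cite: ImpagliazzoEtAl2010, Lemma 3.8 (proof)] -/
def wrongAnswerSteps (P : Finset (Fin k)) (a : Fin k → U) (x : U) :
    Finset (Fin k × (Fin k → U)) :=
  univ.filter fun σ => Answers C P a (f ∘ a) x σ ∧ C (stepTuple P a x σ) σ.1 ≠ f x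

omit [DecidableEq U] in
/-- Wrongly answering steps answer. [folklore] -/
theorem wrongAnswerSteps_subset (P : Finset (Fin k)) (a : Fin k → U) (x : U) :
    wrongAnswerSteps C f P a x ⊆ answerSteps C f P a x :=
  monotone_filter_right _ fun _ _ h => h.1

/-- A product filter indexed by the first coordinate splits as a sum. [folklore] -/
theorem card_filter_prod_eq_sum {ι κ : Type*} [Fintype ι] [Fintype κ] [DecidableEq ι]
    (Q : ι → κ → Prop) [∀ i y, Decidable (Q i y)] :
    (univ.filter fun σ : ι × κ => Q σ.1 σ.2).card = ∑ i, (univ.filter fun y => Q i y).card := by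
  rw [card_eq_sum_card_fiberwise (f := Prod.fst) (t := univ) (fun _ _ => mem_univ _)]
  refine Finset.sum_congr rfl fun i _ => ?_
  refine Finset.card_bij' (fun σ _ => σ.2) (fun y _ => (i, y)) ?_ ?_ ?_ ?_
  · intro σ hσ
    simp only [mem_filter, mem_univ, true_and] at hσ ⊢
    rw [← hσ.2]; exact hσ.1
  · intro y hy
    simp only [mem_filter, mem_univ, true_and] at hy ⊢
    exact ⟨hy, trivial⟩
  · intro σ hσ
    simp only [mem_filter, mem_univ, true_and] at hσ
    rw [← hσ.2]
  · intro y _; rfl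

/-- **Answering steps vs Cons-degree**: `#answerSteps x = |U| · consCnt x`.
[cite: ImpagliazzoEtAl2010, Lemma 3.8 (proof)] -/
theorem card_answerSteps_eq (P : Finset (Fin k)) (a : Fin k → U) (x : U) :
    (answerSteps C f P a x).card = Fintype.card U * consCnt C f P a x := by
  have h1 : (answerSteps C f P a x).card =
      ∑ j, (univ.filter fun y : Fin k → U =>
        j ∉ P ∧ Function.update y j x ∈ cons C f P a).card := by
    rw [answerSteps, ← card_filter_prod_eq_sum]
    congr 1; ext σ; simp only [mem_filter, mem_univ, true_and, answers_iff]
  have h2 : consCnt C f P a x = ∑ j, (univ.filter fun y' : Fin k → U =>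
      j ∉ P ∧ (y' j = x ∧ y' ∈ cons C f P a)).card := by
    rw [consCnt, edges, ← card_filter_prod_eq_sum]
    congr 1; ext σ
    simp only [mem_filter, mem_product, mem_compl, mem_univ, true_and]
    tauto
  rw [h1, h2, Finset.mul_sum]
  refine Finset.sum_congr rfl fun j _ => ?_
  by_cases hj : j ∈ P
  · simp [hj]
  · simp only [hj, not_false_eq_true, true_and]
    rw [card_filter_update j x (fun y' => y' ∈ cons C f P a)]

/-- **Wrongly answering steps vs red degree**: `#wrongAnswerSteps x = |U| · redCnt x`.
[cite: ImpagliazzoEtAl2010, Lemma 3.8 (proof)] -/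
theorem card_wrongAnswerSteps_eq (P : Finset (Fin k)) (a : Fin k → U) (x : U) :
    (wrongAnswerSteps C f P a x).card = Fintype.card U * redCnt C f P a x := by
  have h1 : (wrongAnswerSteps C f P a x).card =
      ∑ j, (univ.filter fun y : Fin k → U => j ∉ P ∧
        (Function.update y j x ∈ cons C f P a ∧ C (fill P a (Function.update y j x)) j ≠ f x)).card := by
    rw [wrongAnswerSteps, ← card_filter_prod_eq_sum]
    congr 1; ext σ
    simp only [mem_filter, mem_univ, true_and, answers_iff, stepTuple, and_assoc]
  have h2 : redCnt C f P a x = ∑ j, (univ.filter fun y' : Fin k → U =>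
      j ∉ P ∧ (y' j = x ∧ (y' ∈ cons C f P a ∧ C (fill P a y') j ≠ f x))).card := by
    rw [redCnt, edges, ← card_filter_prod_eq_sum]
    congr 1; ext σ
    simp only [mem_filter, mem_product, mem_compl, mem_univ, true_and]
    tauto
  rw [h1, h2, Finset.mul_sum]
  refine Finset.sum_congr rfl fun j _ => ?_
  by_cases hj : j ∈ P
  · simp [hj]
  · simp only [hj, not_false_eq_true, true_and]
    rw [card_filter_update j x (fun y' => y' ∈ cons C f P a ∧ C (fill P a y') j ≠ f x)]

/-! ### The decoder errs on few step sequences -/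

variable {C f} in
omit [Fintype U] [DecidableEq U] in
/-- Unfolding the decoder on a step sequence `σ, rest`. [cite: ImpagliazzoEtAl2010, Algorithm 1] -/
theorem decode_cons (P : Finset (Fin k)) (a : Fin k → U) (v : Fin k → R) (d₀ : R) {t : ℕ}
    (σ : Fin k × (Fin k → U)) (rest : Fin t → Fin k × (Fin k → U)) (x : U) :
    decode C P a v d₀ (Fin.cons σ rest : Fin (t + 1) → Fin k × (Fin k → U)) x =
      if Answers C P a v x σ then C (stepTuple P a x σ) σ.1 else decode C P a v d₀ rest x := by
  unfold decode
  rw [List.ofFn_succ]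
  simp only [Fin.cons_zero, Fin.cons_succ, decodeList]

/-- The step sequences on which the decoder (with the true values trusted) errs at `x`.
[cite: ImpagliazzoEtAl2010, Lemma 3.8] -/
def wrongSteps (P : Finset (Fin k)) (a : Fin k → U) (d₀ : R) (t : ℕ) (x : U) :
    Finset (Fin t → Fin k × (Fin k → U)) :=
  univ.filter fun steps => decode C P a (f ∘ a) d₀ steps x ≠ f x

omit [DecidableEq U] in
/-- **One-step recurrence**: `#wrongSteps (t+1) = #wrongAnswerSteps · |S|^t +
(|S| - #answerSteps) · #wrongSteps t` (first step answers wrongly, or does not answer).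
[cite: ImpagliazzoEtAl2010, Lemma 3.8 (proof)] -/
theorem card_wrongSteps_succ (P : Finset (Fin k)) (a : Fin k → U) (d₀ : R) (t : ℕ) (x : U) :
    ((wrongSteps C f P a d₀ (t + 1) x).card : ℝ) =
      (wrongAnswerSteps C f P a x).card * Fintype.card (Fin t → Fin k × (Fin k → U)) +
        (Fintype.card (Fin k × (Fin k → U)) - (answerSteps C f P a x).card) *
          (wrongSteps C f P a d₀ t x).card := by
  classical
  set S := Fin k × (Fin k → U)
  have hcongr : ((wrongSteps C f P a d₀ (t + 1) x).card : ℝ) =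
      ∑ p : S × (Fin t → S), if decode C P a (f ∘ a) d₀ (Fin.cons p.1 p.2 : Fin (t + 1) → S) x ≠ f x
        then (1 : ℝ) else 0 := by
    rw [wrongSteps, natCast_card_filter,
      ← (Fin.consEquiv fun _ : Fin (t + 1) => S).sum_comp]
    rfl
  rw [hcongr, Fintype.sum_prod_type]
  simp only [decode_cons]
  have hsplit : ∀ σ : S, (∑ rest : Fin t → S,
      if (if Answers C P a (f ∘ a) x σ then C (stepTuple P a x σ) σ.1
        else decode C P a (f ∘ a) d₀ rest x) ≠ f x then (1 : ℝ) else 0) =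
      if Answers C P a (f ∘ a) x σ then
        (if C (stepTuple P a x σ) σ.1 ≠ f x then (Fintype.card (Fin t → S) : ℝ) else 0)
      else (wrongSteps C f P a d₀ t x).card := by
    intro σ
    by_cases hA : Answers C P a (f ∘ a) x σ
    · simp only [hA, if_true]
      by_cases hw : C (stepTuple P a x σ) σ.1 ≠ f x
      · rw [if_pos hw]
        simp only [if_pos hw, Finset.sum_const, card_univ, nsmul_eq_mul, mul_one]
      · rw [if_neg hw]
        simp only [if_neg hw, Finset.sum_const_zero]
    · simp only [hA, if_false]
      rw [wrongSteps, natCast_card_filter]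
  simp only [hsplit]
  rw [Finset.sum_ite, Finset.sum_const, nsmul_eq_mul]
  have h1 : (∑ σ ∈ univ.filter (fun σ : S => Answers C P a (f ∘ a) x σ),
      if C (stepTuple P a x σ) σ.1 ≠ f x then (Fintype.card (Fin t → S) : ℝ) else 0) =
      (wrongAnswerSteps C f P a x).card * Fintype.card (Fin t → S) := by
    rw [← Finset.sum_filter, Finset.sum_const, nsmul_eq_mul, filter_filter]
    rfl
  have h2 : ((univ.filter fun σ : S => ¬ Answers C P a (f ∘ a) x σ).card : ℝ) =
      Fintype.card S - (answerSteps C f P a x).card := by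
    have := Finset.card_filter_add_card_filter_not (s := (univ : Finset S))
      (fun σ => Answers C P a (f ∘ a) x σ)
    rw [card_univ] at this
    rw [eq_sub_iff_add_eq, add_comm, answerSteps]
    exact_mod_cast this
  rw [h1, h2]

/-- `#wrongAnswerSteps = h(x) · #answerSteps`. [cite: ImpagliazzoEtAl2010, Lemma 3.8 (proof)] -/
theorem card_wrongAnswerSteps_eq_errFrac_mul (P : Finset (Fin k)) (a : Fin k → U) (x : U) :
    ((wrongAnswerSteps C f P a x).card : ℝ) = errFrac C f P a x * (answerSteps C f P a x).card := by
  rw [card_wrongAnswerSteps_eq, card_answerSteps_eq]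
  push_cast
  rw [mul_left_comm, errFrac_mul_consCnt]

/-- **The decoder errs at `x` on at most `(|S| - #answerSteps x)^t + h(x) · |S|^t` step
sequences** (no step answers, or the first answering step answers wrongly).
[cite: ImpagliazzoEtAl2010, Lemma 3.8 (proof)] -/
theorem card_wrongSteps_le (P : Finset (Fin k)) (a : Fin k → U) (d₀ : R) (x : U) :
    ∀ t : ℕ, ((wrongSteps C f P a d₀ t x).card : ℝ) ≤
      ((Fintype.card (Fin k × (Fin k → U)) : ℝ) - (answerSteps C f P a x).card) ^ t +
        errFrac C f P a x * (Fintype.card (Fin k × (Fin k → U)) : ℝ) ^ t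
  | 0 => by
    have h1 : ((wrongSteps C f P a d₀ 0 x).card : ℝ) ≤ 1 := by
      have : (wrongSteps C f P a d₀ 0 x).card ≤ Fintype.card (Fin 0 → Fin k × (Fin k → U)) :=
        card_filter_le _ _ |>.trans_eq card_univ
      simpa using this
    have h2 := (errFrac_mem_Icc C f P a x).1
    simp only [pow_zero, mul_one]
    linarith
  | t + 1 => by
    have ih := card_wrongSteps_le P a d₀ x t
    rw [card_wrongSteps_succ, card_wrongAnswerSteps_eq_errFrac_mul]
    have hAS' : (answerSteps C f P a x).card ≤ Fintype.card (Fin k × (Fin k → U)) :=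
      (card_filter_le _ _).trans_eq card_univ
    have hAS : ((answerSteps C f P a x).card : ℝ) ≤ (Fintype.card (Fin k × (Fin k → U)) : ℝ) := by
      exact_mod_cast hAS'
    set S : ℝ := (Fintype.card (Fin k × (Fin k → U)) : ℝ)
    set A : ℝ := ((answerSteps C f P a x).card : ℝ)
    set h : ℝ := errFrac C f P a x
    have hSt : (Fintype.card (Fin t → Fin k × (Fin k → U)) : ℝ) = S ^ t := by
      simp [S]
    rw [hSt]
    have h0 : 0 ≤ S - A := sub_nonneg.2 hAS
    have hh := (errFrac_mem_Icc C f P a x).1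
    calc h * A * S ^ t + (S - A) * ((wrongSteps C f P a d₀ t x).card : ℝ)
        ≤ h * A * S ^ t + (S - A) * ((S - A) ^ t + h * S ^ t) := by
          linarith [mul_le_mul_of_nonneg_left ih h0]
      _ = (S - A) ^ (t + 1) + h * S ^ (t + 1) := by ring

/-! ### IJKW Lemma 3.8 (summed over the points) -/

omit [DecidableEq U] in
/-- `|S| = k · |U|^k` for the step space `S = Fin k × (Fin k → U)`. [folklore] -/
theorem card_stepSpace : (Fintype.card (Fin k × (Fin k → U)) : ℝ) = k * Fintype.card (Fin k → U) := by
  rw [Fintype.card_prod, Fintype.card_fin]; push_cast; ring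

/-- For a point that is not starved (`consCnt x · |U| ≥ (ε'/4)(k-s)|U|^k`), the non-answering
steps are at most a `1 - ε'(k-s)/(4k)` fraction, so `t` independent steps all fail to answer on
at most `exp(-t ε'(k-s)/(4k)) · |S|^t` sequences. [cite: ImpagliazzoEtAl2010, Lemma 3.8 (proof)] -/
theorem pow_nonAnswer_le [Nonempty U] {s : ℕ} (hsk : s < k) {P : Finset (Fin k)}
    {a : Fin k → U} {ε' : ℝ} (hε' : 0 ≤ ε') {x : U}
    (hx : ¬ (consCnt C f P a x : ℝ) * Fintype.card U < ε' / 4 * (k - s) * Fintype.card (Fin k → U))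
    (t : ℕ) :
    ((Fintype.card (Fin k × (Fin k → U)) : ℝ) - (answerSteps C f P a x).card) ^ t ≤
      (Fintype.card (Fin k × (Fin k → U)) : ℝ) ^ t * exp (-(t * (ε' * (k - s) / (4 * k)))) := by
  have hk : 0 < k := lt_of_le_of_lt (Nat.zero_le s) hsk
  have hkr : (0 : ℝ) < k := Nat.cast_pos.2 hk
  have hAS' : (answerSteps C f P a x).card ≤ Fintype.card (Fin k × (Fin k → U)) :=
    (card_filter_le _ _).trans_eq card_univ
  have hAS : ((answerSteps C f P a x).card : ℝ) ≤ (Fintype.card (Fin k × (Fin k → U)) : ℝ) := by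
    exact_mod_cast hAS'
  have hA : ε' / 4 * (k - s) * (Fintype.card (Fin k → U) : ℝ) ≤ (answerSteps C f P a x).card := by
    rw [card_answerSteps_eq]; push_cast
    rw [not_lt] at hx; linarith [hx]
  set S : ℝ := (Fintype.card (Fin k × (Fin k → U)) : ℝ) with hSdef
  set K : ℝ := (Fintype.card (Fin k → U) : ℝ) with hKdef
  have hK : 0 < K := Nat.cast_pos.2 Fintype.card_pos
  have hS : S = k * K := card_stepSpace
  set u : ℝ := ε' * (k - s) / (4 * k) with hudef
  have hSu : S * u = ε' / 4 * (k - s) * K := by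
    rw [hS, hudef]; field_simp
  have hks : (0 : ℝ) ≤ k - s := by
    have : (s : ℝ) ≤ k := by exact_mod_cast hsk.le
    linarith
  have hu0 : 0 ≤ u := by positivity
  have hu1 : 0 ≤ 1 - u := by
    have hSpos : 0 < S := by rw [hS]; positivity
    have : S * u ≤ S * 1 := by rw [hSu, mul_one]; exact hA.trans hAS
    nlinarith
  have h1 : S - (answerSteps C f P a x).card ≤ S * (1 - u) := by
    rw [mul_sub, mul_one, hSu]; linarith
  have h0 : 0 ≤ S - (answerSteps C f P a x).card := sub_nonneg.2 hAS
  calc (S - (answerSteps C f P a x).card) ^ t ≤ (S * (1 - u)) ^ t := pow_le_pow_left₀ h0 h1 t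
    _ = S ^ t * (1 - u) ^ t := mul_pow _ _ _
    _ ≤ S ^ t * exp (-u) ^ t := by
        refine mul_le_mul_of_nonneg_left (pow_le_pow_left₀ hu1 ?_ t) (by positivity)
        linarith [add_one_le_exp (-u)]
    _ = S ^ t * exp (-(t * u)) := by rw [← exp_nat_mul, mul_neg]

/-- **IJKW Lemma 3.8, summed form** (true-value variant): over an `α`-excellent row with
`|P| = s`, the decoder with `t` fixed steps errs on at most
`(β + exp(-tε'(k-s)/(4k)) + max(4α, β)) · |U| · |S|^t` pairs (point, step sequence)
(starved points + time-outs + wrong answers), given `exp(-(k-s)β²/2) ≤ ε'/2`.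
[cite: ImpagliazzoEtAl2010, Lemma 3.8] -/
theorem sum_card_wrongSteps_le [Nonempty U] {s : ℕ} (hsk : s < k) {P : Finset (Fin k)}
    (hP : P.card = s) {a : Fin k → U} {ε' α β : ℝ} (hε' : 0 < ε') (hβ : 0 < β)
    (hexc : Excellent C f ε' α P a) (H2 : exp (-((k - s) * β ^ 2 / 2)) ≤ ε' / 2) (d₀ : R)
    (t : ℕ) :
    ∑ x, ((wrongSteps C f P a d₀ t x).card : ℝ) ≤
      (β + exp (-(t * (ε' * (k - s) / (4 * k)))) + max (4 * α) β) * Fintype.card U *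
        (Fintype.card (Fin k × (Fin k → U)) : ℝ) ^ t := by
  classical
  have hA0 : ∀ x, (0 : ℝ) ≤ (Fintype.card (Fin k × (Fin k → U)) : ℝ) - (answerSteps C f P a x).card :=
    fun x => by
    have h' : (answerSteps C f P a x).card ≤ Fintype.card (Fin k × (Fin k → U)) :=
      (card_filter_le _ _).trans_eq card_univ
    have : ((answerSteps C f P a x).card : ℝ) ≤ (Fintype.card (Fin k × (Fin k → U)) : ℝ) := by
      exact_mod_cast h'
    linarith
  set S : ℝ := (Fintype.card (Fin k × (Fin k → U)) : ℝ) with hSdef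
  set N : ℝ := (Fintype.card U : ℝ) with hNdef
  set K : ℝ := (Fintype.card (Fin k → U) : ℝ) with hKdef
  set F := univ.filter fun x : U => (consCnt C f P a x : ℝ) * N < ε' / 4 * (k - s) * K with hFdef
  have hF : (F.card : ℝ) ≤ β * N := card_starved_le C f hsk hP hβ hexc.1 H2
  have hh : ∑ x, errFrac C f P a x ≤ max (4 * α) β * N := sum_errFrac_le C f hsk hP hε' hβ hexc H2
  have hS0 : 0 ≤ S := Nat.cast_nonneg _
  -- pointwise bound, then split the points into starved and not
  have hpt := fun x => card_wrongSteps_le C f P a d₀ x t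
  have hterm : ∀ x, (S - (answerSteps C f P a x).card) ^ t ≤
      (if x ∈ F then S ^ t else S ^ t * exp (-(t * (ε' * (k - s) / (4 * k))))) := by
    intro x
    split_ifs with hx
    · have hAnn : (0 : ℝ) ≤ (answerSteps C f P a x).card := Nat.cast_nonneg _
      exact pow_le_pow_left₀ (hA0 x) (by linarith) t
    · rw [hFdef, mem_filter, not_and] at hx
      exact pow_nonAnswer_le C f hsk hε'.le (hx (mem_univ _)) t
  calc ∑ x, ((wrongSteps C f P a d₀ t x).card : ℝ)
      ≤ ∑ x, ((S - (answerSteps C f P a x).card) ^ t + errFrac C f P a x * S ^ t) :=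
        Finset.sum_le_sum fun x _ => hpt x
    _ = ∑ x, (S - (answerSteps C f P a x).card) ^ t + (∑ x, errFrac C f P a x) * S ^ t := by
        rw [Finset.sum_add_distrib, Finset.sum_mul]
    _ ≤ ∑ x, (if x ∈ F then S ^ t else S ^ t * exp (-(t * (ε' * (k - s) / (4 * k))))) +
          max (4 * α) β * N * S ^ t := by
        refine add_le_add (Finset.sum_le_sum fun x _ => hterm x) ?_
        exact mul_le_mul_of_nonneg_right hh (by positivity)
    _ = F.card * S ^ t + (N - F.card) * (S ^ t * exp (-(t * (ε' * (k - s) / (4 * k))))) +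
          max (4 * α) β * N * S ^ t := by
        rw [Finset.sum_ite, Finset.sum_const, Finset.sum_const, nsmul_eq_mul, nsmul_eq_mul,
          Finset.filter_univ_mem]
        congr 2
        have := Finset.card_filter_add_card_filter_not (s := (univ : Finset U)) (fun x => x ∈ F)
        rw [card_univ, Finset.filter_univ_mem] at this
        have h' : ((univ.filter fun x : U => x ∉ F).card : ℝ) = N - F.card := by
          rw [eq_sub_iff_add_eq, add_comm, hNdef]; exact_mod_cast this
        rw [h']
    _ ≤ β * N * S ^ t + N * (S ^ t * exp (-(t * (ε' * (k - s) / (4 * k))))) +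
          max (4 * α) β * N * S ^ t := by
        have hF0 : (0 : ℝ) ≤ F.card := Nat.cast_nonneg _
        refine add_le_add (add_le_add (mul_le_mul_of_nonneg_right hF (by positivity)) ?_) le_rfl
        exact mul_le_mul_of_nonneg_right (by linarith) (by positivity)
    _ = (β + exp (-(t * (ε' * (k - s) / (4 * k)))) + max (4 * α) β) * N * S ^ t := by ring

/-! ### Fixing the internal randomness (IJKW Remark 3.3) and the main theorem -/

/-- A product filter indexed by the second coordinate splits as a sum. [folklore] -/
theorem card_filter_prod_eq_sum_snd {ι κ : Type*} [Fintype ι] [Fintype κ] [DecidableEq κ]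
    (Q : ι → κ → Prop) [∀ i y, Decidable (Q i y)] :
    (univ.filter fun σ : ι × κ => Q σ.1 σ.2).card = ∑ y, (univ.filter fun i => Q i y).card := by
  rw [card_eq_sum_card_fiberwise (f := Prod.snd) (t := univ) (fun _ _ => mem_univ _)]
  refine Finset.sum_congr rfl fun y _ => ?_
  refine Finset.card_bij' (fun σ _ => σ.1) (fun i _ => (i, y)) ?_ ?_ ?_ ?_
  · intro σ hσ
    simp only [mem_filter, mem_univ, true_and] at hσ ⊢
    rw [← hσ.2]; exact hσ.1
  · intro i hi
    simp only [mem_filter, mem_univ, true_and] at hi ⊢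
    exact ⟨hi, trivial⟩
  · intro σ hσ
    simp only [mem_filter, mem_univ, true_and] at hσ
    rw [← hσ.2]
  · intro i _; rfl

/-- **Fixing the steps** (IJKW Remark 3.3 by Markov's inequality, with the constants of
Thm. 3.2: `β = δ/16`, `α = δ/64`, time-out probability `≤ δ/16`): for an excellent row, at least
`13/16` of the step sequences give a decoder erring on at most `δ|U|` points.
[cite: ImpagliazzoEtAl2010, Remark 3.3 and Thm. 3.2 (proof)] -/
theorem card_goodSteps_ge [Nonempty U] {s : ℕ} (hsk : s < k) {P : Finset (Fin k)}
    (hP : P.card = s) {a : Fin k → U} {ε' δ : ℝ} (hε' : 0 < ε') (hδ : 0 < δ)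
    (hexc : Excellent C f ε' (δ / 64) P a) (H2 : exp (-((k - s) * (δ / 16) ^ 2 / 2)) ≤ ε' / 2)
    {t : ℕ} (H3 : exp (-(t * (ε' * (k - s) / (4 * k)))) ≤ δ / 16) (d₀ : R) :
    (13 / 16 : ℝ) * Fintype.card (Fin t → Fin k × (Fin k → U)) ≤
      ((univ.filter fun steps : Fin t → Fin k × (Fin k → U) =>
        ((univ.filter fun x => decode C P a (f ∘ a) d₀ steps x ≠ f x).card : ℝ) ≤
          δ * Fintype.card U).card : ℝ) := by
  classical
  set A := Fin t → Fin k × (Fin k → U)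
  have hsum := sum_card_wrongSteps_le C f hsk hP hε' (by positivity : (0 : ℝ) < δ / 16) hexc H2 d₀ t
  have hmax : max (4 * (δ / 64)) (δ / 16) = δ / 16 := max_eq_right (le_of_eq (by ring))
  rw [hmax] at hsum
  have hAt : ((Fintype.card (Fin k × (Fin k → U)) : ℝ)) ^ t = Fintype.card A := by simp [A]
  rw [hAt] at hsum
  -- the pairs (steps, point) on which the decoder errs are at most `3δ/16` of all pairs
  have hpairs : ((univ.filter fun p : A × U => decode C P a (f ∘ a) d₀ p.1 p.2 ≠ f p.2).card : ℝ) ≤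
      3 * δ / 16 * (Fintype.card A * Fintype.card U) := by
    rw [card_filter_prod_eq_sum_snd (fun (steps : A) (x : U) => decode C P a (f ∘ a) d₀ steps x ≠ f x)]
    push_cast
    refine (le_of_eq ?_).trans (hsum.trans ?_)
    · rfl
    · have : (0 : ℝ) ≤ Fintype.card U * Fintype.card A := by positivity
      nlinarith [H3]
  -- Markov: few step sequences err on more than `δ|U|` points
  have hheavy := card_heavyRows_le (A := A) (B := U)
    (fun steps x => decode C P a (f ∘ a) d₀ steps x ≠ f x) (η := 3 * δ / 16) (θ := δ) hδ hpairs
  have hfrac : 3 * δ / 16 / δ = 3 / 16 := by field_simp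
  rw [hfrac] at hheavy
  have hcompl := Finset.card_filter_add_card_filter_not (s := (univ : Finset A)) (fun steps : A =>
    δ * Fintype.card U < ((univ.filter fun x => decode C P a (f ∘ a) d₀ steps x ≠ f x).card : ℝ))
  rw [card_univ] at hcompl
  have hc : ((univ.filter fun steps : A => ¬ δ * Fintype.card U <
      ((univ.filter fun x => decode C P a (f ∘ a) d₀ steps x ≠ f x).card : ℝ)).card : ℝ) =
      Fintype.card A - ((univ.filter fun steps : A => δ * Fintype.card U <
        ((univ.filter fun x => decode C P a (f ∘ a) d₀ steps x ≠ f x).card : ℝ)).card : ℝ) := by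
    rw [eq_sub_iff_add_eq, add_comm]; exact_mod_cast hcompl
  simp only [not_lt] at hc
  rw [hc]
  linarith

/-- **Uniform direct-product decoding** (IJKW Thm. 1.2 / CIKK Thm. 4.1 "DP Reconstruction",
true-value variant for learners with membership queries, explicit constants). Let
`C : U^k → R^k` compute `f^k` on at least an `ε` fraction of the `k`-tuples. Draw a uniformly
random set `P` of `s` positions, a uniform tuple `a` (trusted values `f(aᵢ)`, `i ∈ P`) and `t`
uniform sampling steps; then with probability at least `3ε/16` the resulting deterministic decoder
`decode C P a (f ∘ a) d₀ steps` computes `f` on all but a `δ` fraction of `U`, provided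
(`H1`) `k · exp(-s δ (k-s)/(128 k)) ≤ ε² δ (k-s)/1024` (excellence is abundant),
(`H2`) `exp(-(k-s) δ²/512) ≤ ε/4` (the completions sample), and
(`H3`) `exp(-t ε (k-s)/(8k)) ≤ δ/16` (enough steps) — all satisfied for
`s = k/2`, `k = Θ((1/δ) log(1/(εδ)))`, `t = Θ((1/ε) log(1/δ))`.
[cite: ImpagliazzoEtAl2010, Thm. 1.2] -/
theorem directProduct_decoding [Nonempty U] {s t : ℕ} (hsk : s < k) {ε δ : ℝ} (hε : 0 < ε)
    (hδ : 0 < δ)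
    (hC : ε * Fintype.card (Fin k → U) ≤
      ((univ.filter fun B : Fin k → U => errSet C f B = ∅).card : ℝ))
    (H1 : k * exp (-(s * (δ / 64 * (k - s) / 2) / k)) ≤ ε / 4 * (δ / 64 * (k - s) / 2) * (ε / 2))
    (H2 : exp (-((k - s) * (δ / 16) ^ 2 / 2)) ≤ ε / 2 / 2)
    (H3 : exp (-(t * (ε / 2 * (k - s) / (4 * k)))) ≤ δ / 16) (d₀ : R) :
    3 * ε / 16 * ((rows k s U).card * Fintype.card (Fin t → Fin k × (Fin k → U))) ≤
      ((((rows k s U) ×ˢ (univ : Finset (Fin t → Fin k × (Fin k → U)))).filter fun q =>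
        ((univ.filter fun x => decode C q.1.1 q.1.2 (f ∘ q.1.2) d₀ q.2 x ≠ f x).card : ℝ) ≤
          δ * Fintype.card U).card : ℝ) := by
  classical
  set A := Fin t → Fin k × (Fin k → U)
  set G : (Finset (Fin k) × (Fin k → U)) × A → Prop := fun q =>
    ((univ.filter fun x => decode C q.1.1 q.1.2 (f ∘ q.1.2) d₀ q.2 x ≠ f x).card : ℝ) ≤
      δ * Fintype.card U with hG
  set excRows := (rows k s U).filter fun p : Finset (Fin k) × (Fin k → U) =>
    Excellent C f (ε / 2) (δ / 64) p.1 p.2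
  have hexc := card_excellent_ge C f hsk (ε' := ε / 2) (ε'' := ε / 4) (α := δ / 64)
    (by positivity) (by positivity) hC H1
  have hε4 : ε - ε / 2 - ε / 4 = ε / 4 := by ring
  rw [hε4] at hexc
  -- count the good pairs row by row
  have hcount : ((((rows k s U) ×ˢ (univ : Finset A)).filter G).card : ℝ) =
      ∑ p ∈ rows k s U, (((univ : Finset A).filter fun steps => G (p, steps)).card : ℝ) := by
    rw [natCast_card_filter, Finset.sum_product]
    refine Finset.sum_congr rfl fun p _ => ?_
    rw [natCast_card_filter]
  rw [hcount]
  have hrow : ∀ p ∈ excRows, (13 / 16 : ℝ) * Fintype.card A ≤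
      (((univ : Finset A).filter fun steps => G (p, steps)).card : ℝ) := by
    intro p hp
    obtain ⟨hp, he⟩ := mem_filter.1 hp
    exact card_goodSteps_ge C f hsk (mem_rows.1 hp) (by positivity) hδ he H2 H3 d₀
  calc 3 * ε / 16 * (((rows k s U).card : ℝ) * Fintype.card A)
      ≤ ε / 4 * (rows k s U).card * ((13 / 16 : ℝ) * Fintype.card A) := by
        have : (0 : ℝ) ≤ (rows k s U).card * Fintype.card A := by positivity
        nlinarith
    _ ≤ excRows.card * ((13 / 16 : ℝ) * Fintype.card A) :=
        mul_le_mul_of_nonneg_right hexc (by positivity)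
    _ = ∑ _p ∈ excRows, (13 / 16 : ℝ) * Fintype.card A := by rw [Finset.sum_const, nsmul_eq_mul]
    _ ≤ ∑ p ∈ excRows, (((univ : Finset A).filter fun steps => G (p, steps)).card : ℝ) :=
        Finset.sum_le_sum hrow
    _ ≤ ∑ p ∈ rows k s U, (((univ : Finset A).filter fun steps => G (p, steps)).card : ℝ) :=
        Finset.sum_le_sum_of_subset_of_nonneg (filter_subset _ _) fun _ _ _ => Nat.cast_nonneg _

/-! ### The trusted positions as `k` coin bits (uniform over ALL subsets) -/

/-- The position set read off `k` coin bits. [folklore] -/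
def posSet (Pb : Fin k → Bool) : Finset (Fin k) := univ.filter fun j => Pb j = true

/-- `posSet` is a bijection between coin strings and subsets. [folklore] -/
def posSetEquiv (k : ℕ) : (Fin k → Bool) ≃ Finset (Fin k) where
  toFun := posSet
  invFun P := fun j => decide (j ∈ P)
  left_inv Pb := by funext j; simp [posSet]
  right_inv P := by ext j; simp [posSet]

/-- The hypotheses `H1`–`H3` of `directProduct_decoding` hold uniformly for `k/4 ≤ s ≤ 3k/4`
under their uniform versions. [folklore] -/
theorem uniform_hyps {s t : ℕ} (hk : 0 < k) (hs1 : k ≤ 4 * s) (hs2 : 4 * s ≤ 3 * k)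
    {ε δ : ℝ} (hε : 0 < ε) (hδ : 0 < δ)
    (H1u : exp (-(3 * δ * k / 2048)) ≤ ε ^ 2 * δ / 4096)
    (H2u : exp (-(k * δ ^ 2 / 2048)) ≤ ε / 4)
    (H3u : exp (-(t * ε / 32)) ≤ δ / 16) :
    (k * exp (-(s * (δ / 64 * (k - s) / 2) / k)) ≤ ε / 4 * (δ / 64 * (k - s) / 2) * (ε / 2)) ∧
    (exp (-((k - s) * (δ / 16) ^ 2 / 2)) ≤ ε / 2 / 2) ∧
    (exp (-(t * (ε / 2 * (k - s) / (4 * k)))) ≤ δ / 16) := by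
  have hkr : (0 : ℝ) < k := Nat.cast_pos.2 hk
  have hs1r : (k : ℝ) ≤ 4 * s := by exact_mod_cast hs1
  have hs2r : 4 * (s : ℝ) ≤ 3 * k := by exact_mod_cast hs2
  have hks : (k : ℝ) / 4 ≤ k - s := by linarith
  have hprod : 3 * (k : ℝ) / 16 ≤ s * (k - s) / k := by
    rw [le_div_iff₀ hkr]
    nlinarith
  refine ⟨?_, ?_, ?_⟩
  · -- H1
    have hexp : exp (-(s * (δ / 64 * (k - s) / 2) / k)) ≤ exp (-(3 * δ * k / 2048)) := by
      rw [exp_le_exp, neg_le_neg_iff]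
      have : s * (δ / 64 * ((k : ℝ) - s) / 2) / k = δ / 128 * (s * (k - s) / k) := by ring
      rw [this]
      nlinarith [mul_le_mul_of_nonneg_left hprod (by positivity : (0 : ℝ) ≤ δ / 128)]
    calc (k : ℝ) * exp (-(s * (δ / 64 * (k - s) / 2) / k)) ≤ k * (ε ^ 2 * δ / 4096) :=
          mul_le_mul_of_nonneg_left (hexp.trans H1u) hkr.le
      _ = ε / 4 * (δ / 64 * (k / 4) / 2) * (ε / 2) := by ring
      _ ≤ ε / 4 * (δ / 64 * (k - s) / 2) * (ε / 2) := by
          have h0 : (0 : ℝ) ≤ ε / 4 := by positivity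
          have h1 : δ / 64 * ((k : ℝ) / 4) / 2 ≤ δ / 64 * (k - s) / 2 := by nlinarith
          nlinarith [mul_le_mul_of_nonneg_left h1 h0]
  · -- H2
    refine le_trans ?_ (le_trans H2u (le_of_eq (by ring)))
    rw [exp_le_exp, neg_le_neg_iff]
    nlinarith [mul_le_mul_of_nonneg_right hks (by positivity : (0 : ℝ) ≤ δ ^ 2)]
  · -- H3
    refine le_trans ?_ H3u
    rw [exp_le_exp, neg_le_neg_iff]
    have hq : (1 : ℝ) / 4 ≤ (k - s) / k := by rw [le_div_iff₀ hkr]; linarith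
    have : (t : ℝ) * ε / 32 = t * (ε / 2 * (1 / 4) / 4) := by ring
    rw [this]
    have h0 : (0 : ℝ) ≤ t * (ε / 2) := by positivity
    calc (t : ℝ) * (ε / 2 * (1 / 4) / 4) = t * (ε / 2) * (1 / 4) / 4 := by ring
      _ ≤ t * (ε / 2) * ((k - s) / k) / 4 := by nlinarith [mul_le_mul_of_nonneg_left hq h0]
      _ = t * (ε / 2 * (k - s) / (4 * k)) := by field_simp

/-- Most coin strings give a position set of size between `k/4` and `3k/4` (Hoeffding).
[folklore] -/
theorem card_balanced_ge (hk : 0 < k) :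
    (1 - 2 * exp (-(k / 8 : ℝ))) * Fintype.card (Fin k → Bool) ≤
      ((univ.filter fun Pb : Fin k → Bool =>
        k ≤ 4 * (posSet Pb).card ∧ 4 * (posSet Pb).card ≤ 3 * k).card : ℝ) := by
  classical
  have h := card_deviation_le_exp (α := Bool) (fun b => b = true) hk (η := 1 / 4) (by norm_num)
  have hhalf : ((univ.filter fun b : Bool => b = true).card : ℝ) / Fintype.card Bool = 1 / 2 := by
    rw [Fintype.card_bool]
    have : (univ.filter fun b : Bool => b = true) = {true} := by ext b; simp
    rw [this, card_singleton]; norm_num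
  rw [hhalf] at h
  have hexp : exp (-2 * k * (1 / 4 : ℝ) ^ 2) = exp (-(k / 8 : ℝ)) := by congr 1; ring
  rw [hexp] at h
  -- the unbalanced coin strings deviate by at least k/4 from k/2
  have hsub : (univ.filter fun Pb : Fin k → Bool =>
      ¬ (k ≤ 4 * (posSet Pb).card ∧ 4 * (posSet Pb).card ≤ 3 * k)) ⊆
      (univ.filter fun ω : Fin k → Bool => (k : ℝ) * (1 / 4) ≤
        |((univ.filter fun i => ω i = true).card : ℝ) - k * (1 / 2)|) := by
    intro Pb hPb
    rw [mem_filter] at hPb ⊢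
    refine ⟨mem_univ _, ?_⟩
    have hne := hPb.2
    rw [not_and_or, not_le, not_le] at hne
    have hc : ((univ.filter fun i => Pb i = true).card : ℝ) = (posSet Pb).card := rfl
    rw [hc, le_abs]
    rcases hne with h1 | h2
    · right
      have : (4 * (posSet Pb).card : ℝ) < k := by exact_mod_cast h1
      linarith
    · left
      have : (3 * k : ℝ) < 4 * (posSet Pb).card := by exact_mod_cast h2
      linarith
  have hbad : ((univ.filter fun Pb : Fin k → Bool =>
      ¬ (k ≤ 4 * (posSet Pb).card ∧ 4 * (posSet Pb).card ≤ 3 * k)).card : ℝ) ≤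
      2 * exp (-(k / 8 : ℝ)) * Fintype.card (Fin k → Bool) :=
    le_trans (by exact_mod_cast card_le_card hsub) h
  have hcompl := Finset.card_filter_add_card_filter_not (s := (univ : Finset (Fin k → Bool)))
    (fun Pb => k ≤ 4 * (posSet Pb).card ∧ 4 * (posSet Pb).card ≤ 3 * k)
  rw [card_univ] at hcompl
  have : ((univ.filter fun Pb : Fin k → Bool =>
      k ≤ 4 * (posSet Pb).card ∧ 4 * (posSet Pb).card ≤ 3 * k).card : ℝ) =
      Fintype.card (Fin k → Bool) - ((univ.filter fun Pb : Fin k → Bool =>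
        ¬ (k ≤ 4 * (posSet Pb).card ∧ 4 * (posSet Pb).card ≤ 3 * k)).card : ℝ) := by
    rw [eq_sub_iff_add_eq]; exact_mod_cast hcompl
  rw [this]
  nlinarith [hbad]

/-- **Uniform direct-product decoding with the trusted positions drawn as `k` coin bits**
(each position trusted independently with probability `1/2`, i.e. `P` uniform over all
subsets): under the uniform hypotheses (`H1u`) `exp(-3δk/2048) ≤ ε²δ/4096`,
(`H2u`) `exp(-kδ²/2048) ≤ ε/4`, (`H3u`) `exp(-tε/32) ≤ δ/16`, at least a
`(3ε/16)(1 - 2e^{-k/8})` fraction of the triples (coin bits, trusted tuple, steps) give a decoder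
with at most `δ|U|` errors. This is the form consumed by a learner whose randomness is a string of
uniform bits. [cite: ImpagliazzoEtAl2010, Thm. 1.2] -/
theorem directProduct_decoding_bits [Nonempty U] {t : ℕ} (hk : 0 < k) {ε δ : ℝ} (hε : 0 < ε)
    (hδ : 0 < δ)
    (hC : ε * Fintype.card (Fin k → U) ≤
      ((univ.filter fun B : Fin k → U => errSet C f B = ∅).card : ℝ))
    (H1u : exp (-(3 * δ * k / 2048)) ≤ ε ^ 2 * δ / 4096)
    (H2u : exp (-(k * δ ^ 2 / 2048)) ≤ ε / 4)
    (H3u : exp (-(t * ε / 32)) ≤ δ / 16) (d₀ : R) :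
    3 * ε / 16 * (1 - 2 * exp (-(k / 8 : ℝ))) *
        Fintype.card ((Fin k → Bool) × (Fin k → U) × (Fin t → Fin k × (Fin k → U))) ≤
      ((univ.filter fun q : (Fin k → Bool) × (Fin k → U) × (Fin t → Fin k × (Fin k → U)) =>
        ((univ.filter fun x =>
          decode C (posSet q.1) q.2.1 (f ∘ q.2.1) d₀ q.2.2 x ≠ f x).card : ℝ) ≤
            δ * Fintype.card U).card : ℝ) := by
  classical
  set A := Fin t → Fin k × (Fin k → U)
  set G : Finset (Fin k) → (Fin k → U) → A → Prop := fun P a steps =>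
    ((univ.filter fun x => decode C P a (f ∘ a) d₀ steps x ≠ f x).card : ℝ) ≤
      δ * Fintype.card U with hG
  -- count by position set
  have hcount : ((univ.filter fun q : (Fin k → Bool) × (Fin k → U) × A =>
      G (posSet q.1) q.2.1 q.2.2).card : ℝ) =
      ∑ P : Finset (Fin k), ((univ.filter fun r : (Fin k → U) × A => G P r.1 r.2).card : ℝ) := by
    rw [natCast_card_filter, Fintype.sum_prod_type]
    have hφ : ∀ Pb : Fin k → Bool,
        (∑ r : (Fin k → U) × A, if G (posSet Pb) r.1 r.2 then (1 : ℝ) else 0) =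
          ((univ.filter fun r : (Fin k → U) × A => G (posSet Pb) r.1 r.2).card : ℝ) :=
      fun Pb => by rw [natCast_card_filter]
    simp only [hφ]
    exact (posSetEquiv k).sum_comp
      (fun P => ((univ.filter fun r : (Fin k → U) × A => G P r.1 r.2).card : ℝ))
  -- the per-size bound from the fixed-size theorem
  have hsize : ∀ s : ℕ, k ≤ 4 * s → 4 * s ≤ 3 * k →
      3 * ε / 16 * (k.choose s * Fintype.card (Fin k → U) * Fintype.card A) ≤
        ∑ P ∈ univ.powersetCard s, ((univ.filter fun r : (Fin k → U) × A => G P r.1 r.2).card : ℝ) := by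
    intro s hs1 hs2
    have hsk : s < k := by omega
    obtain ⟨H1, H2, H3⟩ := uniform_hyps (t := t) hk hs1 hs2 hε hδ H1u H2u H3u
    have h := directProduct_decoding C f hsk hε hδ hC H1 H2 H3 d₀
    rw [card_rows] at h
    push_cast at h
    refine (le_of_eq (by ring)).trans (h.trans (le_of_eq ?_))
    rw [rows, natCast_card_filter, Finset.sum_product, Finset.sum_product]
    refine Finset.sum_congr rfl fun P _ => ?_
    rw [natCast_card_filter, Fintype.sum_prod_type]
  -- the balanced position sets
  set φ : Finset (Fin k) → ℝ := fun P =>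
    ((univ.filter fun r : (Fin k → U) × A => G P r.1 r.2).card : ℝ) with hφ
  set bal : ℕ → Prop := fun s => k ≤ 4 * s ∧ 4 * s ≤ 3 * k with hbal
  set T := (univ : Finset (Finset (Fin k))).filter fun P => bal P.card with hT
  have hφ0 : ∀ P, 0 ≤ φ P := fun P => Nat.cast_nonneg _
  -- `|T| ≥ (1 - 2 e^{-k/8}) 2^k`
  have hTcard : (1 - 2 * exp (-(k / 8 : ℝ))) * Fintype.card (Fin k → Bool) ≤ (T.card : ℝ) := by
    refine (card_balanced_ge hk).trans (le_of_eq ?_)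
    congr 1
    rw [hT, ← Finset.map_univ_equiv (posSetEquiv k), Finset.filter_map, Finset.card_map]
    rfl
  -- fibres of `T` by size
  have hmaps : ∀ P ∈ T, P.card ∈ range (k + 1) := fun P _ =>
    mem_range.2 (Nat.lt_succ_of_le ((card_le_univ P).trans_eq (Fintype.card_fin k)))
  have hfib : ∀ s, T.filter (fun P => P.card = s) = if bal s then univ.powersetCard s else ∅ := by
    intro s
    split_ifs with hs
    · ext P
      simp only [hT, mem_filter, mem_univ, true_and, mem_powersetCard, subset_univ]
      constructor
      · exact fun h => h.2
      · intro h; exact ⟨h ▸ hs, h⟩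
    · ext P
      simp only [hT, mem_filter, mem_univ, true_and, Finset.notMem_empty, iff_false, not_and]
      intro hP hPs
      exact hs (hPs ▸ hP)
  have hTsum : ∑ P ∈ T, φ P = ∑ s ∈ range (k + 1), if bal s then ∑ P ∈ univ.powersetCard s, φ P else 0 := by
    rw [← Finset.sum_fiberwise_of_maps_to hmaps]
    refine Finset.sum_congr rfl fun s _ => ?_
    rw [hfib s]
    split_ifs <;> simp
  have hTcard' : (T.card : ℝ) = ∑ s ∈ range (k + 1), if bal s then (k.choose s : ℝ) else 0 := by
    rw [card_eq_sum_card_fiberwise hmaps]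
    push_cast
    refine Finset.sum_congr rfl fun s _ => ?_
    rw [hfib s]
    split_ifs <;> simp [card_powersetCard]
  -- assemble
  have hKA : (0 : ℝ) ≤ Fintype.card (Fin k → U) * Fintype.card A := by positivity
  rw [hcount]
  calc 3 * ε / 16 * (1 - 2 * exp (-(k / 8 : ℝ))) *
        (Fintype.card ((Fin k → Bool) × (Fin k → U) × A) : ℝ)
      = 3 * ε / 16 * (Fintype.card (Fin k → U) * Fintype.card A) *
          ((1 - 2 * exp (-(k / 8 : ℝ))) * Fintype.card (Fin k → Bool)) := by
        rw [Fintype.card_prod, Fintype.card_prod]; push_cast; ring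
    _ ≤ 3 * ε / 16 * (Fintype.card (Fin k → U) * Fintype.card A) * T.card :=
        mul_le_mul_of_nonneg_left hTcard (by positivity)
    _ = ∑ s ∈ range (k + 1), if bal s then
          3 * ε / 16 * (k.choose s * Fintype.card (Fin k → U) * Fintype.card A) else 0 := by
        rw [hTcard', Finset.mul_sum]
        refine Finset.sum_congr rfl fun s _ => ?_
        split_ifs <;> ring
    _ ≤ ∑ s ∈ range (k + 1), if bal s then ∑ P ∈ univ.powersetCard s, φ P else 0 := by
        refine Finset.sum_le_sum fun s _ => ?_
        split_ifs with hs
        · exact hsize s hs.1 hs.2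
        · exact le_rfl
    _ = ∑ P ∈ T, φ P := hTsum.symm
    _ ≤ ∑ P, φ P := Finset.sum_le_sum_of_subset_of_nonneg (subset_univ _) fun P _ _ => hφ0 P

end DirectProduct

end Literature.Computability.Complexity
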